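import Summits.AtomisticToContinuum.FouriersLaw.Theses.CageBudgetFekete

/-!
# Line `ratio-floor` — crux `QuasiSuperadditiveHeatVariance` (stmt-AtomisticToContinuum-15769), route CageBudgetFekete

Strategist `--alt` line (planner-cstrat-stmt-AtomisticToContinuum-15769-b1-0, 2026-08-17), registered beside
`Lines/birth.lean`.

Crux (route decl `Summit.AtomisticToContinuum.FouriersLaw.Theses.CageBudgetFekete.QuasiSuperadditiveHeatVariance`):
for `pinnedChain ω₂ lam β γ` (`ω₂, lam, β > 0`), every `T > 0` and every guarded pair `(μ, D)` with absolutely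
convergent, continuous summed current autocorrelation `C(t) = D.currentCorrelation μ t`, the heat variance
`V(τ) = 2∫_{(0,τ]} (τ−s) C(s) ds` satisfies `∃ K ≥ 0, ∀ s t ≥ 0, V s + V t ≤ V (s+t) + K`.

## The line (two stubs): ALMOST-MONOTONE DIFFUSIVITY RATIO + A FLOOR FOR THE RUNNING FIRST MOMENT

Lever.  Write `g(τ) := V(τ)/τ` (the finite-time diffusivity, up to `2T²`).  Since `V(τ) = 2τ∫₀^τ C − 2∫₀^τ s C(s) ds`
and `V′(τ) = 2∫₀^τ C`, one has the RATIO IDENTITY `τ² g′(τ) = τ V′(τ) − V(τ) = 2 G(τ)` with the RUNNING FIRST MOMENT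
OF THE MEMORY `G(τ) := ∫_{(0,τ]} s C(s) ds`.  A star-shaped function (`g` non-decreasing, `V(0) = 0`) is superadditive
(Bruckner–Ostrow 1962); the quantitative version is: if `G ≥ −K′` on `[0,∞)` then `g′ ≥ −2K′/τ²`, so for `0 < s ≤ u`
`g(u) ≥ g(s) − 2K′(1/s − 1/u)`, and therefore, for `s, t > 0`,
`V(s+t) = s·g(s+t) + t·g(s+t) ≥ s g(s) + t g(t) − 2K′[(1 − s/(s+t)) + (1 − t/(s+t))] = V(s) + V(t) − 2K′`.
So a FLOOR for the running first moment is a cage budget: `K = 2K′`.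

Physical reading of the floor.  `V′ = 2∫₀^τ C =: κ_run(τ)` is the running Green–Kubo integral and
`2G(τ) = τκ_run(τ) − V(τ) = ∫₀^τ (κ_run(τ) − κ_run(u)) du`; the floor `G ≥ −K′` says: THE AREA BY WHICH THE RUNNING
GREEN–KUBO INTEGRAL OVERSHOOTS ITS CURRENT VALUE IS BOUNDED (the "cage lobe" may make `κ_run` rise and fall back, but
the overshoot area `∫₀^τ (κ_run(u) − κ_run(τ))⁺ du` stays bounded up to the undershoot area).  Equivalently
`‖Q_τ‖² ≤ 2τ⟨J, Q_τ⟩ + 2K′` per site (`Q_τ = ∫₀^τ J∘φ_u du`): the window-end current keeps at least half the typical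
interior correlation with the window's heat, up to `K′/τ`.

Why this is not `birth` again.  `birth` bounds the adjacent-window covariance kernel pointwise (`0 ≤ m_{s,t} ≤ w`) and
bets on the ABSOLUTE first moment of the NEGATIVE part, `∫ w·C⁻(w) dw < ∞` (stub M).  Here the load-bearing quantity is
the SIGNED running moment `G(τ) = ∫₀^τ s C(s) ds`, bounded BELOW only: `stub_firstMomentFloor` is implied by stub M
(`G ≥ −∫₀^∞ s C⁻`) and is strictly weaker — it tolerates sign-changing memories whose negative part has infinite first
moment as long as the oscillation cancels (e.g. `C(t) ∼ cos(Ωt) t^{−a}`, `1 < a ≤ 2`, the family the skeleton-vet of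
`birth` flagged as "satisfy Q but kill M"), and it tolerates every positive heavy tail (`G → +∞` is allowed).  It is
still only SUFFICIENT: a non-decaying oscillatory component of `C_T` (an atom of the current spectral measure at a
frequency `ω₀ ≠ 0`) keeps Q true (bounded contribution `4/ω₀²` to `V`) but makes `G` unbounded below; that failure
mode is the business of the companion line `spectral-germ` (low-pass reduction), not of this one.

* `stub_ratioFloorSuperadditive` — the real-analysis half (true for EVERY continuous `C : ℝ → ℝ`; provable now,
  M-sized: `V` is differentiable on `(0,∞)` with `V′(τ) = 2∫₀^τ C` (FTC for the continuous integrands `C` and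
  `s ↦ s C(s)` after rewriting `V(τ) = 2τ∫₀^τ C − 2∫₀^τ sC`), the ratio identity, monotonicity of
  `τ ↦ V(τ)/τ − 2K′/τ` on `(0,∞)` from the sign of its derivative, and the three-line algebra above; `s = 0` or
  `t = 0` is trivial since `V 0 = 0`).
* `stub_firstMomentFloor` — the physical half, the bet of this line: in the crux's arena,
  `∃ K′, ∀ τ ≥ 0, −K′ ≤ ∫_{(0,τ]} s · C_T(s) ds`.  `K′ = 0` at the harmonic member (`C ≡ C(0) > 0`, `G = C(0)τ²/2`) and
  in the kinetic corner (completely monotone limit memory, `C ≥ 0`); finite wherever `t·C_T⁻ ∈ L¹` (birth's M); the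
  bet beyond that is cancellation of sign-changing tails.  Why it might fail: a negative algebraic tail `−t^{−a}`,
  `a ≤ 2`, of the SUMMED-current memory (the route's recorded kill; `a = 2` gives `G ∼ −log τ`, exactly the landed
  negative lemma's witness), or a persistent (non-decaying) oscillation of `C_T`.

Assembly (sorry-free): `K := 2 · max K′ 0`; the floor with `K′` implies the floor with `max K′ 0`, and stub A at
`C := C_T` gives the crux inequality.  `QuasiSuperadditiveHeatVariance_of : Registered.stub_ratioFloorSuperadditive →
Registered.stub_firstMomentFloor → CageBudgetFekete.QuasiSuperadditiveHeatVariance` concludes the crux BY NAME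
(`Registered.stub_x := type_of% stub_x`), and `QuasiSuperadditiveHeatVariance_of_stubs` instantiates it.

Costume / shred check: stub A is parameter-free real analysis and does not hold the uniform budget (it holds for
`C ≡ −1`, where its hypothesis fails and `V(s)+V(t)−V(s+t) = 2st`); stub F says nothing about `V` and is not implied by
the crux (pure tone: Q true, F false) nor by the Green–Kubo shell (the landed negative lemma's witness
`C = 4(1+|t|)⁻³ − (1+|t|)⁻²` has `G(τ) → −∞` like `−log τ`, so F correctly FAILS on it — F is not an instance the
negative lemma refutes, and F is exactly what that lemma says a proof must supply beyond `L¹`); neither stub mentions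
steady states or `FouriersLaw`.

Disproof used: no `Disproof.lean` exists for this crux (payload `disproof_path` absent; `ledger crux ls`: Lines/birth.*
only).  Landed negative lemma honoured: `Theorems/QuasiSuperadditiveHeatVariance/Negative/GreenKuboShellInsufficient.lean`
(`quasiSuperadditiveHeatVariance_false_without_dynamics`, refuter-rattack 2026-08-17): any proof must use more than
the Green–Kubo shell — this line uses it at `stub_firstMomentFloor` (the floor is false for the lemma's witness).
`ledger negatives --problem AtomisticToContinuum` (21 entries): none concerns closed-chain current autocorrelations.
-/

namespace Summit.AtomisticToContinuum.FouriersLaw.Cruxes.QuasiSuperadditiveHeatVariance.RatioFloor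

open MeasureTheory Set Filter Topology
open Literature.MathematicalPhysics.KineticTheory.HeatConduction

/-- STUB A — RATIO FLOOR ⟹ QUASI-SUPERADDITIVITY (pure real analysis; true for every continuous memory).
For continuous `C : ℝ → ℝ`, `V(τ) = 2∫_{(0,τ]} (τ−s) C(s) ds` and a constant `K′` with
`−K′ ≤ ∫_{(0,τ]} s C(s) ds` for all `τ ≥ 0`: `V s + V t ≤ V (s+t) + 2K′` for all `s, t ≥ 0`.
Proof sketch: `V(τ) = 2τ∫₀^τ C − 2∫₀^τ sC`, `V′(τ) = 2∫₀^τ C`, so `τV′ − V = 2∫₀^τ sC ≥ −2K′`, i.e.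
`(V(τ)/τ)′ ≥ −2K′/τ²` on `(0,∞)`; hence `τ ↦ V(τ)/τ − 2K′/τ` is non-decreasing there, which gives
`V(u)/u ≥ V(s)/s − 2K′(1/s − 1/u)` for `0 < s ≤ u`; apply at `u = s + t` twice and add (`V 0 = 0` settles the
boundary cases). [cite: doi:10.2140/pjm.1962.12.1203 (Bruckner–Ostrow 1962: star-shaped ⇒ superadditive); Helfand1960] -/
theorem stub_ratioFloorSuperadditive :
    ∀ C : ℝ → ℝ, Continuous C → ∀ V : ℝ → ℝ,
      V = (fun τ : ℝ => 2 * ∫ s in Set.Ioc (0:ℝ) τ, (τ - s) * C s) →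
    ∀ K' : ℝ, (∀ τ : ℝ, 0 ≤ τ → -K' ≤ ∫ s in Set.Ioc (0:ℝ) τ, s * C s) →
    ∀ s t : ℝ, 0 ≤ s → 0 ≤ t → V s + V t ≤ V (s + t) + 2 * K' := by
  sorry

/-- STUB F — FLOOR FOR THE RUNNING FIRST MOMENT OF THE MEMORY (the physical half; "bounded overshoot area of
the running Green–Kubo integral").  In the crux's arena — `pinnedChain ω₂ lam β γ` (`ω₂, lam, β > 0`), `T > 0`,
`μ` a shift- and momentum-reversal-invariant Gibbs state at `T`, `D` a `μ`-preserving shift-covariant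
infinite-volume dynamics with absolutely convergent, continuous `C_T(t) = D.currentCorrelation μ t` — the running
first moment of the memory is bounded below: `∃ K′, ∀ τ ≥ 0, −K′ ≤ ∫_{(0,τ]} s · C_T(s) ds`.
`K′ = 0` wherever `C_T ≥ 0` (harmonic member; kinetic corner); `K′ ≤ ∫₀^∞ s C_T⁻` whenever that is finite
(line `birth`, stub M); the extra bet is cancellation of sign-changing tails.  Strictly weaker than stub M of
`birth`, not implied by the crux, false for the Green–Kubo-shell witness of the landed negative lemma.
[cite: Helfand1960; Gaspard2022 §3.2.9 (3.116)–(3.117); AokiLukkarinenSpohn2006 (3.25); LukkarinenSpohn2008 Prop 2.4;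
DeRoeckHuveneers2015 Thm 1 (delimiter)] -/
theorem stub_firstMomentFloor :
    ∀ ω₂ lam β γ : ℝ, 0 < ω₂ → 0 < lam → 0 < β → ∀ T : ℝ, 0 < T →
    ∀ μ : Measure ChainConfig, (pinnedChain ω₂ lam β γ).IsChainGibbsMeasure T μ →
      IsShiftInvariant μ →
      μ.map (fun σ : ChainConfig => fun x : ℤ => ((σ x).1, -(σ x).2)) = μ →
    ∀ D : InfiniteChainDynamics (pinnedChain ω₂ lam β γ), D.PreservesMeasure μ →
      (∀ t : ℝ, ∀ᵐ σ ∂μ, D.flow t (shift σ) = shift (D.flow t σ)) →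
      (∀ t : ℝ, D.HasAbsConvergentCorrelation μ t) →
      Continuous (fun t : ℝ => D.currentCorrelation μ t) →
    ∃ K' : ℝ, ∀ τ : ℝ, 0 ≤ τ →
      -K' ≤ ∫ s in Set.Ioc (0:ℝ) τ, s * D.currentCorrelation μ s := by
  sorry

/-! ### By-name statements of the registered stubs -/

namespace Registered

/-- Statement of registered stub A (`stub_ratioFloorSuperadditive`), by name. -/
def stub_ratioFloorSuperadditive : Prop := type_of% RatioFloor.stub_ratioFloorSuperadditive

/-- Statement of registered stub F (`stub_firstMomentFloor`), by name. -/
def stub_firstMomentFloor : Prop := type_of% RatioFloor.stub_firstMomentFloor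

end Registered

/-- **Skeleton theorem (kernel-checked, no `sorry`): the two stubs give the crux
`CageBudgetFekete.QuasiSuperadditiveHeatVariance` BY NAME.**  Cage budget `K := 2 · max K′ 0`. [folklore] -/
theorem QuasiSuperadditiveHeatVariance_of (hA : Registered.stub_ratioFloorSuperadditive)
    (hF : Registered.stub_firstMomentFloor) :
    _root_.Summit.AtomisticToContinuum.FouriersLaw.Theses.CageBudgetFekete.QuasiSuperadditiveHeatVariance := by
  intro ω₂ lam β γ hω hl hβ T hT μ hG hSI hRefl D hP hShift hAC hC V hV
  obtain ⟨K', hK'⟩ := hF ω₂ lam β γ hω hl hβ T hT μ hG hSI hRefl D hP hShift hAC hC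
  refine ⟨2 * max K' 0, by positivity, fun s t hs ht => ?_⟩
  have hfloor : ∀ τ : ℝ, 0 ≤ τ →
      -(max K' 0) ≤ ∫ u in Set.Ioc (0:ℝ) τ, u * D.currentCorrelation μ u := fun τ hτ =>
    le_trans (neg_le_neg (le_max_left K' 0)) (hK' τ hτ)
  exact hA (fun w => D.currentCorrelation μ w) hC V hV (max K' 0) hfloor s t hs ht

/-- The registered stubs instantiate the skeleton theorem: the crux BY NAME, its only `sorry`s being those of
`stub_ratioFloorSuperadditive` and `stub_firstMomentFloor`. [folklore] -/
theorem QuasiSuperadditiveHeatVariance_of_stubs :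
    _root_.Summit.AtomisticToContinuum.FouriersLaw.Theses.CageBudgetFekete.QuasiSuperadditiveHeatVariance :=
  QuasiSuperadditiveHeatVariance_of stub_ratioFloorSuperadditive stub_firstMomentFloor

end Summit.AtomisticToContinuum.FouriersLaw.Cruxes.QuasiSuperadditiveHeatVariance.RatioFloor
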